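import Summits.HubbardSuperconductivity.HubbardSuperconductivity.Theorems.BalabanIRBirGroundStateAverageLRO
import Literature.MathematicalPhysics.QuantumLattice.FinDimSpectrumSectorGibbsLimit
import Literature.MathematicalPhysics.QuantumLattice.GriffithsLemmaGroundStates
import Literature.MathematicalPhysics.QuantumLattice.HubbardWave0LiebProofs

/-!
# Strategist sketch — crux `stmt-HubbardSuperconductivity-2079` (`BalabanIR.BirGroundStateAverageLRO`)

Companion Lean file of `STRATEGY-CENSUS.md` (crux-strategist, unit
`cstrat-stmt-HubbardSuperconductivity-2079-s2`, 2026-08-17). It TYPES the objects the census talks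
about — the strengthenings S⁺1/S⁺2, the three decompositions D1 (variational sandwich), D2
(pointwise floor + window uniformisation), D4 (the route's own engine chain) — and proves the
glue directions that are pure logic / one-line linear algebra, so that the census can point at
checked signatures instead of prose. Nothing here asserts the crux; no `sorry`.

* `AvgBoundAt`, `crux_iff_avgBoundAt` — the crux with explicit parameters (`Iff.rfl`; same text as
  the standing disprover's `Disproof.AvgBoundAt`).
* S⁺1 `EveryGroundStateWindowLRO` ⟹ crux (`crux_of_everyGroundStateWindowLRO`, tree
  `birGroundStateAverageLRO_of_forall_groundState`). This is, up to constants 2 and 8, the line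
  `Sketch`'s only stub (tree `exists_freeFloorWindow_iff_exists_everyGroundStateLRO`, p99569) and it
  implies the summit (tree `freePenalisedFloorSummit`, p137379).
* S⁺2 `GappedEveryGroundStateWindowLRO` (S⁺1 plus a volume-uniform sector gap) ⟹ S⁺1.
* D1 `groundState_expect_ge_of_sandwich` (abstract, proved) and its Hubbard instance
  `everyGS_of_variationalSandwich` : paired trial state below a threshold `E*` ∧ every weakly
  paired sector state above `E*` ⟹ S⁺1 (hence the crux). The census explains why the second
  piece is the whole problem (condensation energy `e^{-c/U²}` per site against an `O(U²)`
  correlation-energy uncertainty; `GeneralizedHartreeFockNoPairing` forbids anchoring `E*` in a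
  quasi-free computation).
* D2 `PointwiseFloorWindow` ∧ `WindowUniformisation` ⟹ crux (`crux_of_pointwise_of_uniformisation`).
* D4 `crux_of_engineChain : BirComplexStableXYR → BirGappedPhaseReductionR → crux` — the route's
  own split (crux 3 is proved), recorded to show it EXISTS at route level; the census (§4 D4)
  explains why it is not re-filed as a split of this node (14846's census: `h2R` is inert).
-/

set_option linter.dupNamespace false

namespace Summit.HubbardSuperconductivity.HubbardSuperconductivity.Cruxes.BirGroundStateAverageLRO.Strategist

open Matrix Literature.MathematicalPhysics.QuantumLattice
open Summit.HubbardSuperconductivity.HubbardSuperconductivity.Theses.BalabanIR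
open Summit.HubbardSuperconductivity.HubbardSuperconductivity.Theorems

/-! ## §0 The crux with explicit parameters -/

/-- The inner predicate of the crux at doping `δ`, coupling `U`, constant `c`, side `L`
(body copied verbatim from `BalabanIR.BirGroundStateAverageLRO`). -/
def AvgBoundAt (δ U c : ℝ) (L : ℕ) [NeZero L] : Prop :=
  let N : ℕ := 2 * ⌊(1 - δ) * (L : ℝ) ^ 2 / 2⌋₊
  let H := hubbardTorus 2 L 1 U
  let S := szSector (Λ := FermionTorus 2 L) N 0
  let E₀ := S ⊓ Module.End.eigenspace (Matrix.toLin' H) ((H.minEnergyOn S : ℝ) : ℂ)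
  let P := projMatrix (E₀.map (Fock.toEuclidean (ι := Orb (FermionTorus 2 L)) :
    Fock (Orb (FermionTorus 2 L)) →ₗ[ℂ] EuclideanSpace ℂ (Finset (Orb (FermionTorus 2 L)))))
  c * (L : ℝ) ^ 4 * P.trace.re ≤
    (P * ((pairField dWaveFormFactor L)ᴴ * pairField dWaveFormFactor L)).trace.re

/-- The crux, restated through `AvgBoundAt` (definitional). -/
theorem crux_iff_avgBoundAt :
    BirGroundStateAverageLRO ↔
      ∃ δ ∈ Set.Ioo (0:ℝ) (1/2), ∃ U₁ U₂ c : ℝ, 0 < U₁ ∧ U₁ < U₂ ∧ 0 < c ∧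
        ∀ U ∈ Set.Ioo U₁ U₂, ∃ L₀ : ℕ, ∀ (L : ℕ) [NeZero L], L₀ ≤ L → Even L →
          AvgBoundAt δ U c L :=
  Iff.rfl

/-! ## §S Strengthenings -/

/-- **S⁺1 — EVERY-ground-state window LRO.** For some `δ ∈ (0,1/2)`, window `0 < U₁ < U₂` and
`c > 0`: for every `U` in the window, eventually in even `L`, every normalised `(N_L, S^z = 0)`-sector
ground state of `hubbardTorus 2 L 1 U` has `Re ⟨ψ, Δ_d†Δ_d ψ⟩ ≥ c L⁴`. Strictly stronger than the
crux (average); equivalent (constants 2, 8) to line `Sketch`'s stub `stub_freePenalisedFloor`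
(p99569) and summit-strength (p137379). -/
def EveryGroundStateWindowLRO : Prop :=
  ∃ δ ∈ Set.Ioo (0:ℝ) (1/2), ∃ U₁ U₂ c : ℝ, 0 < U₁ ∧ U₁ < U₂ ∧ 0 < c ∧
    ∀ U ∈ Set.Ioo U₁ U₂, ∃ L₀ : ℕ, ∀ (L : ℕ) [NeZero L], L₀ ≤ L → Even L →
      ∀ ψ : Fock (Orb (FermionTorus 2 L)),
        IsGroundStateInSector (hubbardTorus 2 L 1 U) (2 * ⌊(1 - δ) * (L : ℝ) ^ 2 / 2⌋₊) 0 ψ →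
        star ψ ⬝ᵥ ψ = 1 →
        c * (L : ℝ) ^ 4 ≤
          (star ψ ⬝ᵥ ((pairField dWaveFormFactor L)ᴴ * pairField dWaveFormFactor L) *ᵥ ψ).re

/-- S⁺1 ⟹ crux (state-wise bound ⟹ trace bound; tree). -/
theorem crux_of_everyGroundStateWindowLRO (h : EveryGroundStateWindowLRO) :
    BirGroundStateAverageLRO :=
  birGroundStateAverageLRO_of_forall_groundState h

/-- **S⁺2 — the "gapped phase" rigid form.** S⁺1 together with a VOLUME-UNIFORM spectral gap
`γ > 0` above the ground multiplet INSIDE the `(N_L, S^z = 0)` sector (every unit sector vector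
orthogonal to all sector ground states has energy `≥ e₀ + γ`). This is the shape the stability
theorems for gapped phases would need (Bravyi–Hastings–Michalakis; Michalakis–Zwolak
doi:10.1007/s00220-013-1762-6; De Roeck–Salmhofer doi:10.1007/s00220-018-3211-z; Hastings
doi:10.1063/1.5053869). The census (§3 S⁺2) records why it is FALSE in substance for a `U(1)`-ordered
state (Anderson–Bogoliubov phase mode at energy `~ 1/L` inside the fixed-`N` sector) and why, even
granting a gap, the stability route dies at `U/Δ_BCS ~ U·e^{+c/U²} → ∞`. -/
def GappedEveryGroundStateWindowLRO : Prop :=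
  ∃ δ ∈ Set.Ioo (0:ℝ) (1/2), ∃ U₁ U₂ c γ : ℝ, 0 < U₁ ∧ U₁ < U₂ ∧ 0 < c ∧ 0 < γ ∧
    ∀ U ∈ Set.Ioo U₁ U₂, ∃ L₀ : ℕ, ∀ (L : ℕ) [NeZero L], L₀ ≤ L → Even L →
      (∀ ψ : Fock (Orb (FermionTorus 2 L)),
        IsGroundStateInSector (hubbardTorus 2 L 1 U) (2 * ⌊(1 - δ) * (L : ℝ) ^ 2 / 2⌋₊) 0 ψ →
        star ψ ⬝ᵥ ψ = 1 →
        c * (L : ℝ) ^ 4 ≤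
          (star ψ ⬝ᵥ ((pairField dWaveFormFactor L)ᴴ * pairField dWaveFormFactor L) *ᵥ ψ).re) ∧
      (∀ φ : Fock (Orb (FermionTorus 2 L)),
        φ ∈ szSector (Λ := FermionTorus 2 L) (2 * ⌊(1 - δ) * (L : ℝ) ^ 2 / 2⌋₊) 0 →
        star φ ⬝ᵥ φ = 1 →
        (∀ ψ : Fock (Orb (FermionTorus 2 L)),
          IsGroundStateInSector (hubbardTorus 2 L 1 U) (2 * ⌊(1 - δ) * (L : ℝ) ^ 2 / 2⌋₊) 0 ψ →
          star ψ ⬝ᵥ φ = 0) →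
        (hubbardTorus 2 L 1 U).minEnergyOn
            (szSector (Λ := FermionTorus 2 L) (2 * ⌊(1 - δ) * (L : ℝ) ^ 2 / 2⌋₊) 0) + γ ≤
          (star φ ⬝ᵥ (hubbardTorus 2 L 1 U) *ᵥ φ).re)

/-- S⁺2 ⟹ S⁺1 (drop the gap clause). -/
theorem everyGS_of_gapped (h : GappedEveryGroundStateWindowLRO) : EveryGroundStateWindowLRO := by
  obtain ⟨δ, hδ, U₁, U₂, c, γ, hU₁, hU₁₂, hc, _hγ, h⟩ := h
  refine ⟨δ, hδ, U₁, U₂, c, hU₁, hU₁₂, hc, fun U hU => ?_⟩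
  obtain ⟨L₀, hL₀⟩ := h U hU
  exact ⟨L₀, fun L _ hL hE => (hL₀ L hL hE).1⟩

/-! ## §D1 Decomposition by a variational sandwich (paired trial state + "weak pairing costs energy") -/

section Abstract

variable {n : Type*} [Fintype n] [DecidableEq n]

/-- **Abstract sandwich lemma (proved).** If some unit vector of the sector `K` has energy `< E*`
and every unit vector of `K` with `Re ⟨ψ, A ψ⟩ < m` has energy `≥ E*`, then every sector ground
state (unit eigenvector of `H` at `minEnergyOn H K`) has `Re ⟨ψ, A ψ⟩ ≥ m`. -/
theorem groundState_expect_ge_of_sandwich {H A : Matrix n n ℂ} (hH : H.IsHermitian)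
    (K : Submodule ℂ (n → ℂ)) {Estar m : ℝ}
    (hvar : ∃ φ ∈ K, star φ ⬝ᵥ φ = 1 ∧ (star φ ⬝ᵥ H *ᵥ φ).re < Estar)
    (hcost : ∀ ψ ∈ K, star ψ ⬝ᵥ ψ = 1 → (star ψ ⬝ᵥ A *ᵥ ψ).re < m →
      Estar ≤ (star ψ ⬝ᵥ H *ᵥ ψ).re)
    {ψ : n → ℂ} (hψK : ψ ∈ K) (hψ1 : star ψ ⬝ᵥ ψ = 1)
    (heig : H *ᵥ ψ = ((H.minEnergyOn K : ℝ) : ℂ) • ψ) :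
    m ≤ (star ψ ⬝ᵥ A *ᵥ ψ).re := by
  by_contra hlt
  push Not at hlt
  obtain ⟨φ, hφK, hφ1, hφE⟩ := hvar
  have h1 : H.minEnergyOn K ≤ (star φ ⬝ᵥ H *ᵥ φ).re :=
    minEnergyOn_le_rayleigh_of_mem hH K hφK hφ1
  have h2 : Estar ≤ (star ψ ⬝ᵥ H *ᵥ ψ).re := hcost ψ hψK hψ1 hlt
  have h3 : (star ψ ⬝ᵥ H *ᵥ ψ).re = H.minEnergyOn K :=
    re_rayleigh_of_eigen_minEnergyOn H K hψ1 heig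
  linarith

end Abstract

/-- **D1a — a paired trial state beats the threshold.** For every `U` in the window, eventually in
even `L`, some unit vector of the `(N_L, S^z = 0)` sector has energy `< E*(U,L)`. (With `E*` = the
would-be normal-state energy and a BCS/Kohn–Luttinger trial state, the margin is the condensation
energy `~ ρ Δ² L² ~ e^{-2c/U²} L²`.) -/
def PairedTrialBeatsThreshold (Estar : ℝ → ℕ → ℝ) (δ U₁ U₂ : ℝ) : Prop :=
  ∀ U ∈ Set.Ioo U₁ U₂, ∃ L₀ : ℕ, ∀ (L : ℕ) [NeZero L], L₀ ≤ L → Even L →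
    ∃ φ : Fock (Orb (FermionTorus 2 L)),
      φ ∈ szSector (Λ := FermionTorus 2 L) (2 * ⌊(1 - δ) * (L : ℝ) ^ 2 / 2⌋₊) 0 ∧
      star φ ⬝ᵥ φ = 1 ∧
      (star φ ⬝ᵥ (hubbardTorus 2 L 1 U) *ᵥ φ).re < Estar U L

/-- **D1b — weakly paired states cost energy.** For every `U` in the window, eventually in even
`L`, every unit sector vector with `Re ⟨ψ, Δ_d†Δ_d ψ⟩ < x L⁴` has energy `≥ E*(U,L)`. This piece is
the whole crux: it is a statement about the infimum of the Hubbard energy over the "normal"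
(weakly paired) part of the sector to accuracy `e^{-2c/U²}` per site. -/
def UnpairedStatesAboveThreshold (Estar : ℝ → ℕ → ℝ) (δ U₁ U₂ x : ℝ) : Prop :=
  ∀ U ∈ Set.Ioo U₁ U₂, ∃ L₀ : ℕ, ∀ (L : ℕ) [NeZero L], L₀ ≤ L → Even L →
    ∀ ψ : Fock (Orb (FermionTorus 2 L)),
      ψ ∈ szSector (Λ := FermionTorus 2 L) (2 * ⌊(1 - δ) * (L : ℝ) ^ 2 / 2⌋₊) 0 →
      star ψ ⬝ᵥ ψ = 1 →
      (star ψ ⬝ᵥ ((pairField dWaveFormFactor L)ᴴ * pairField dWaveFormFactor L) *ᵥ ψ).re <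
          x * (L : ℝ) ^ 4 →
      Estar U L ≤ (star ψ ⬝ᵥ (hubbardTorus 2 L 1 U) *ᵥ ψ).re

/-- **D1 glue (proved): D1a ∧ D1b ⟹ S⁺1** (hence the crux, `crux_of_everyGroundStateWindowLRO`).
Note the output is again EVERY-ground-state order: the sandwich cannot see the average. -/
theorem everyGS_of_variationalSandwich
    (h : ∃ δ ∈ Set.Ioo (0:ℝ) (1/2), ∃ U₁ U₂ x : ℝ, 0 < U₁ ∧ U₁ < U₂ ∧ 0 < x ∧
      ∃ Estar : ℝ → ℕ → ℝ,
        PairedTrialBeatsThreshold Estar δ U₁ U₂ ∧ UnpairedStatesAboveThreshold Estar δ U₁ U₂ x) :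
    EveryGroundStateWindowLRO := by
  obtain ⟨δ, hδ, U₁, U₂, x, hU₁, hU₁₂, hx, Estar, hA, hB⟩ := h
  refine ⟨δ, hδ, U₁, U₂, x, hU₁, hU₁₂, hx, fun U hU => ?_⟩
  obtain ⟨L₁, hL₁⟩ := hA U hU
  obtain ⟨L₂, hL₂⟩ := hB U hU
  refine ⟨max L₁ L₂, fun L _ hL hE ψ hgs hψ1 => ?_⟩
  have hA' := hL₁ L (le_trans (le_max_left _ _) hL) hE
  have hB' := hL₂ L (le_trans (le_max_right _ _) hL) hE
  obtain ⟨φ, hφS, hφ1, hφE⟩ := hA'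
  have hH : (hubbardTorus 2 L 1 U).IsHermitian :=
    hubbardTorus_isHermitian (hamiltonian_isHermitian_and_commute_holds _) 1 U
  exact groundState_expect_ge_of_sandwich hH _ ⟨φ, hφS, hφ1, hφE⟩
    (fun ψ' hψ'S hψ'1 hlt => hB' ψ' hψ'S hψ'1 hlt) hgs.1 hψ1 hgs.2.2

/-- D1 ⟹ crux. -/
theorem crux_of_variationalSandwich
    (h : ∃ δ ∈ Set.Ioo (0:ℝ) (1/2), ∃ U₁ U₂ x : ℝ, 0 < U₁ ∧ U₁ < U₂ ∧ 0 < x ∧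
      ∃ Estar : ℝ → ℕ → ℝ,
        PairedTrialBeatsThreshold Estar δ U₁ U₂ ∧ UnpairedStatesAboveThreshold Estar δ U₁ U₂ x) :
    BirGroundStateAverageLRO :=
  crux_of_everyGroundStateWindowLRO (everyGS_of_variationalSandwich h)

/-! ## §D2 Decomposition along the coupling axis: pointwise floor + window uniformisation -/

/-- **D2a — pointwise-in-`U` floor.** At every coupling of the window the GS-average bound holds
eventually in even `L` with its OWN constant `c_U > 0` (the crux with `∃ c` moved inside `∀ U`). At
each single `U > 0` this is still the open problem. -/
def PointwiseFloorWindow (δ U₁ U₂ : ℝ) : Prop :=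
  ∀ U ∈ Set.Ioo U₁ U₂, ∃ c : ℝ, 0 < c ∧ ∃ L₀ : ℕ, ∀ (L : ℕ) [NeZero L], L₀ ≤ L → Even L →
    AvgBoundAt δ U c L

/-- **D2b — window uniformisation.** Pointwise floors on a window give a UNIFORM floor on a
sub-window. By Baire category this is provable OFF the Kato level-crossing couplings `⋃_L C_L`
(lead c18's `--supports` helper; `U ↦ tr(P_U A)/tr P_U` is continuous on the complement of the
finite set `C_L`); AT a crossing coupling the ground eigenspace may acquire extra analytic branches
touching `e₀` from above, whose pair expectation nothing controls — so as typed (all `U` of the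
sub-window) it is not provable from D2a, and the crux's extra content at crossing couplings is
never consumed downstream (crux 5 picks a generic `U`). -/
def WindowUniformisation : Prop :=
  ∀ (δ U₁ U₂ : ℝ), δ ∈ Set.Ioo (0:ℝ) (1/2) → 0 < U₁ → U₁ < U₂ → PointwiseFloorWindow δ U₁ U₂ →
    ∃ U₁' U₂' c : ℝ, U₁ ≤ U₁' ∧ U₁' < U₂' ∧ U₂' ≤ U₂ ∧ 0 < c ∧
      ∀ U ∈ Set.Ioo U₁' U₂', ∃ L₀ : ℕ, ∀ (L : ℕ) [NeZero L], L₀ ≤ L → Even L → AvgBoundAt δ U c L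

/-- **D2 glue (proved): D2a on some window ∧ D2b ⟹ crux.** -/
theorem crux_of_pointwise_of_uniformisation
    (hpt : ∃ δ ∈ Set.Ioo (0:ℝ) (1/2), ∃ U₁ U₂ : ℝ, 0 < U₁ ∧ U₁ < U₂ ∧ PointwiseFloorWindow δ U₁ U₂)
    (hunif : WindowUniformisation) : BirGroundStateAverageLRO := by
  obtain ⟨δ, hδ, U₁, U₂, hU₁, hU₁₂, hpw⟩ := hpt
  obtain ⟨U₁', U₂', c, h1, h12, _h2, hc, h⟩ := hunif δ U₁ U₂ hδ hU₁ hU₁₂ hpw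
  exact crux_iff_avgBoundAt.2 ⟨δ, hδ, U₁', U₂', c, lt_of_lt_of_le hU₁ h1, h12, hc, h⟩

/-! ## §D4 The route's own engine chain (exists at ROUTE level; not re-filed as a split of this node) -/

/-- **D4: engine `2R` + reduction `4R` ⟹ crux** (crux 3 `BirBdGPhaseCoercivity` is PROVED, so the
route's `closes` derives the target as `h4R h2R h3`). Recorded here only to certify that the split
exists already as route structure; see the census §4 D4 for why filing it as this node's
decomposition would be costume (14846's strategist census: the typed `h2R` exports nothing a
Hubbard dictionary can consume, p89422 / p89798, so `4R` is `X_avg` in substance). -/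
theorem crux_of_engineChain (h2R : BirComplexStableXYR) (h4R : BirGappedPhaseReductionR) :
    BirGroundStateAverageLRO :=
  h4R h2R BirBdGPhaseCoercivity_holds

/-! ## §N Negation — the shape of a counterexample -/

/-- **¬crux, unfolded:** for EVERY `δ ∈ (0,1/2)`, every window `0 < U₁ < U₂` and every `c > 0`
there is a coupling in the window at which the GS-average bound fails for infinitely many even
`L` — a dense (in `U`) absence-of-order statement at `T = 0` for the 2D Hubbard ground state, for
which no technique exists at any `U > 0` (the landed `Negative/*` corner lemmas bound `c` from
above by `O(U log(1/U))`, `2(1-δ²)`, …, never by `0`). -/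
def DenseAbsenceOfOrder : Prop :=
  ∀ δ ∈ Set.Ioo (0:ℝ) (1/2), ∀ U₁ U₂ c : ℝ, 0 < U₁ → U₁ < U₂ → 0 < c →
    ∃ U ∈ Set.Ioo U₁ U₂, ∀ L₀ : ℕ, ∃ (L : ℕ) (_ : NeZero L), L₀ ≤ L ∧ Even L ∧ ¬ AvgBoundAt δ U c L

/-- `DenseAbsenceOfOrder` refutes the crux (the converse also holds classically; only this
direction is needed to read a counterexample). -/
theorem not_crux_of_denseAbsence (h : DenseAbsenceOfOrder) : ¬ BirGroundStateAverageLRO := by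
  intro hX
  obtain ⟨δ, hδ, U₁, U₂, c, hU₁, hU₁₂, hc, hw⟩ := crux_iff_avgBoundAt.1 hX
  obtain ⟨U, hU, hbad⟩ := h δ hδ U₁ U₂ c hU₁ hU₁₂ hc
  obtain ⟨L₀, hL₀⟩ := hw U hU
  obtain ⟨L, hLnz, hL, hE, hnot⟩ := hbad L₀
  exact hnot (@hL₀ L hLnz hL hE)

end Summit.HubbardSuperconductivity.HubbardSuperconductivity.Cruxes.BirGroundStateAverageLRO.Strategist
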